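import Summits.Ventures.HSemireg.LeadingDigitRemainder
import Summits.Ventures.HSemireg.EdgeDigitParametrisation
import Summits.Ventures.HSemireg.LeadingDigitCoverage
import Summits.Ventures.HSemireg.TwoVectorDividedPowers
import Summits.Ventures.HSemireg.EdgeUnitClosedForms
import Summits.Ventures.HSemireg.MixedFrameClassDead

/-!
# The (2,2,3,3,3,3) edge unit is CLASS-DEAD — one theorem (pub-hsemireg, S4-PUSH corner 2)

Kernel leg of seat s4-search-2 gen 16 (cell `pub-hsemireg`); FILE II of the composition announced in
`EdgeUnitClosedForms.lean`.  Memo of record `s4push/search-2/g11/LIFT2-search-2-g11.md` («S2-21») §2 ∕ §5 (LEMMAS A(a),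
B, D(a)); RESULT «S2-19» ADDENDUM B = S4-PR-54 ∕ second code «S2-21» = S4-PR-57 (the 83 twisted M2 census classes of dual
type `(2,2,3,3,3,3)`); framework PREREG-S2-18∕19 (CRITERION L).  Of record before this file (PEN-NOTE g15 DELTA 6): the
edge unit's CLASS-DEAD route is «a composition of tree theorems — criterion at `k = 2` ⇒ digit equation
(`LeadingDigitRemainder.edge_digit_equation`) ⇒ clause (`DigitSpaceClause.digitSpace_clause`) ⇒ lemmaB's parametrisation
(`EdgeDigitParametrisation`) ⇒ `v₂(T₃) = 8 < 10` (`TwoAdicReadings.lemmaB_reading`); the other 27 leading digits by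
`LeadingDigitRemainder.lemmaD_a_reading` ∕ `lemmaA_a_chain` — GIVEN (1) the enumeration of the 28 non-degenerate leading digits
with their parity ∕ functional data and (2) the registered closed forms of the divided powers».  GIVEN (1) is
`LeadingDigitCoverage.trichotomy` (gen 16, ROW G); GIVEN (2) is `TwoVectorDividedPowers.exists_dividedPowers_of_mem_span`
(ROW H: divided powers of integral 2-forms exist in `Λ`) + `EdgeUnitClosedForms` (they are the registered closed forms) +
`LeadingDigitRemainder.natCast_mul_cancel` (uniqueness).  This file performs the composition.

**THE STATEMENT (`edge_unit_classDead`).**  `M` a free `ℤ`-module with a basis `x : Fin 12` (`ℤ¹² = H¹(E⁶, ℤ)`), slots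
`hᵢ = ι x_{2i} ι x_{2i+1}`, `H = h₀ + h₁`, `S₁, S₂, S₃` the elementary symmetric functions of `h₂, …, h₅`, cross lines
`l₁, …, l₄`; the type: `D = 4H + 8S₁` with its registered divided powers `D₂, D₃`; the signature: `σ₁ = 0`, `σ₀ = 2s + 1`,
`σ₂ = 4t − σ₀`, `σ₃ = 4u` (`s, t, u` any even elements); the CLASS 2-FORM: `B = C + 2X` with `C = β₀₁h₀ + β₂₃h₁ + n₁l₁ + ⋯ +
n₄l₄` an INTEGRAL leading digit on the slot pair with ODD Pfaffian `β₀₁β₂₃ + (n₂n₃ − n₁n₄) = 2p + 1` (non-degenerate) and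
`X = Σ_{i<j} c i j • ι xᵢ ι xⱼ` ANY integral 2-form (66 integer coefficients; `B ≡ C mod 2`, every completion of the
digit); `B₂, B₃` ANY elements with `B·B = 2B₂`, `B·B·B = 6B₃` (the divided powers `B^[2]`, `B^[3]` — they exist in `Λ`
by ROW H and are unique by torsion-freeness); the registered `T₂(B) = σ₂D₂ − 4σ₁DB + 16σ₀B₂`,
`T₃(B) = σ₃D₃ − 4σ₂D₂B + 16σ₁DB₂ − 64σ₀B₃`.  CONCLUSION: for every even `Z₂` and every `Z₃`,
NOT (`T₂(B) = 64·Z₂` AND `T₃(B) = 1024·Z₃`) — CRITERION L (`T_k ≡ 0 mod 2^{m(2k−1)}`, `m = 2`, `k = 2, 3`) fails for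
EVERY integral 2-form of the edge type over a non-degenerate leading digit: the unit carries no `(G, Schur)`-design class,
i.e. the 83 classes are CLASS-DEAD, as ONE kernel theorem with no enumerative or closed-form GIVEN.

**Proof** (`LeadingDigitCoverage.trichotomy` on the integers `β₀₁, β₂₃, nᵢ`): (1) `β₀₁ + β₂₃` odd ⇒
`lemmaD_a_reading` (`T₃ ∉ 256Λ`, a fortiori `∉ 1024Λ`); (2) a cross-line functional with even pairing ⇒ `lemmaA_a_chain`
(`T₂ = 64Z₂` is absurd); (3) `C ≡ H mod 2` ⇒ `B = H + 2X'` (`X' = X + A` integral) ⇒ `edge_digit_equation` ⇒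
`digitSpace_clause` (61 parities of `X' − S₁`) ⇒ `EdgeDigitParametrisation.parametrisation_identity` (`X' = S₁ + L + ηH +
2E′`, `E′` an explicit integral 2-form) ⇒ `B = (1 + 2η)H + 2S₁ + 2L + 4E′` ⇒ `lemmaB_reading` (`T₃ ∉ 1024Λ`).  In each
branch the registered closed forms are produced from `B₂, B₃` by `EdgeUnitClosedForms` + ROW H (divided powers of `X`,
`X'`, `E′`) + `natCast_mul_cancel`.

Scope ∕ honest framing: this is the CLASS-LEVEL statement for ONE unit (the `(2,2,3,3,3,3)` edge, `q = 4`) of a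
NECESSARY-condition sieve (CRITERION L) at the special fibre `E⁶`; that CRITERION L is the registered necessary condition
for a `(G, Schur)`-design, the signature table (which `σ` occur: STRUCTURE LEMMA S4-PR-42) and the census (which classes
carry this unit) are the memo's framework and are not formalised; LEMMA C, the `E = ∅` units, the other clique types'
end-to-end statements and the `(1,2,3,3,3,3)` frame (LEMMA A(b), `MixedFrameGlue` ∕ `lemmaA_b_reading`) are not in this
file.  Theorems only (count-neutral, no `def`); no object, no `σ` computation, no Hodge statement; nothing here bears
on HC ∕ HC_CM ∕ HC_AV.
-/

namespace Summit.Ventures.HSemireg.EdgeUnitClassDead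

open ExteriorAlgebra TwoSlotFrameTable TwoAdicReadings LeadingDigitRemainder DigitSpaceClause EdgeDigitParametrisation
  LeadingDigitCoverage TwoVectorDividedPowers EdgeUnitClosedForms
open scoped IsMulCommutative
open MixedFrameClassDead (cancel_two twoForm_mem_span)

variable {M : Type*} [AddCommGroup M] [Module ℤ M]

-- `twoForm_mem_span` (every integral 2-form on the basis lies in the span of the 2-vectors) and `cancel_two` are the LANDED
-- declarations of `MixedFrameClassDead` (ROW K), imported and opened above — not restated here (gate `dedup.landed`).

/-- A cast multiple of a 2-vector lies in the span of the 2-vectors. -/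
theorem intCast_mul_twoVector_mem_span (k : ℤ) (u v : M) :
    (k : ExteriorAlgebra ℤ M) * (ι ℤ u * ι ℤ v) ∈ Submodule.span ℤ (Set.range fun p : M × M => ι ℤ p.1 * ι ℤ p.2) := by
  rw [← zsmul_eq_mul]
  exact Submodule.smul_mem _ _ (Submodule.subset_span ⟨(u, v), rfl⟩)

/-- Cancelling `6`. -/
theorem cancel_six (x : Module.Basis (Fin 12) ℤ M) {Q Q' : ExteriorAlgebra ℤ M} (h : (6 : ExteriorAlgebra ℤ M) * Q = 6 * Q') :
    Q = Q' :=
  natCast_mul_cancel x 6 (by norm_num) Q Q' (by exact_mod_cast h)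

set_option maxHeartbeats 2000000 in
/-- **THE (2,2,3,3,3,3) EDGE UNIT IS CLASS-DEAD.**  See the module docstring for the reading of every hypothesis.  For a
free `ℤ`-module `M` with basis `x : Fin 12`, an integral leading digit `C = β₀₁h₀ + β₂₃h₁ + Σ nᵢlᵢ` with odd Pfaffian, ANY
integral 2-form `X` (66 coefficients `c i j`), the class 2-form `B = C + 2X` with divided powers `B₂, B₃`
(`B·B = 2B₂`, `B·B·B = 6B₃`), the edge type `D = 4H + 8S₁` and a signature with `σ₁ = 0`, `σ₀ = 2s + 1`,
`σ₂ = 4t − σ₀`, `σ₃ = 4u`: the registered `T₂(B)`, `T₃(B)` are never simultaneously `≡ 0 mod 2⁶Λ` and `≡ 0 mod 2¹⁰`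
— CRITERION L fails at `k = 2` or at `k = 3` for every completion of every non-degenerate leading digit. -/
theorem edge_unit_classDead (x : Module.Basis (Fin 12) ℤ M) (Λ : Subalgebra ℤ (ExteriorAlgebra ℤ M))
    (h₀ h₁ l₁ l₂ l₃ l₄ h₂ h₃ h₄ h₅ σ₀ σ₁ σ₂ σ₃ s t u H H₂ S₁ S₂ S₃ D D₂ D₃ C X B B₂ B₃ T₂ T₃ : ExteriorAlgebra ℤ M)
    (β₀₁ β₂₃ n₁ n₂ n₃ n₄ p : ℤ) (c : Fin 12 → Fin 12 → ℤ)
    (hΛ : Λ = Algebra.adjoin ℤ (Set.range fun p : M × M => ι ℤ p.1 * ι ℤ p.2))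
    (hh₀ : h₀ = ι ℤ (x 0) * ι ℤ (x 1)) (hh₁ : h₁ = ι ℤ (x 2) * ι ℤ (x 3)) (hl₁ : l₁ = ι ℤ (x 0) * ι ℤ (x 2))
    (hl₂ : l₂ = ι ℤ (x 0) * ι ℤ (x 3)) (hl₃ : l₃ = ι ℤ (x 1) * ι ℤ (x 2)) (hl₄ : l₄ = ι ℤ (x 1) * ι ℤ (x 3))
    (hh₂ : h₂ = ι ℤ (x 4) * ι ℤ (x 5)) (hh₃ : h₃ = ι ℤ (x 6) * ι ℤ (x 7)) (hh₄ : h₄ = ι ℤ (x 8) * ι ℤ (x 9))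
    (hh₅ : h₅ = ι ℤ (x 10) * ι ℤ (x 11)) (ms : s ∈ Λ) (mt : t ∈ Λ) (mu : u ∈ Λ)
    (hH : H = h₀ + h₁) (hH₂ : H₂ = h₀ * h₁) (hS₁ : S₁ = h₂ + h₃ + h₄ + h₅)
    (hS₂ : S₂ = h₂ * h₃ + h₂ * h₄ + h₂ * h₅ + h₃ * h₄ + h₃ * h₅ + h₄ * h₅)
    (hS₃ : S₃ = h₂ * h₃ * h₄ + h₂ * h₃ * h₅ + h₂ * h₄ * h₅ + h₃ * h₄ * h₅)
    (hD : D = 4 * H + 8 * S₁) (hD₂ : D₂ = 16 * H₂ + 32 * (H * S₁) + 64 * S₂)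
    (hD₃ : D₃ = 128 * (H₂ * S₁) + 256 * (H * S₂) + 512 * S₃)
    (hC : C = (β₀₁ : ExteriorAlgebra ℤ M) * h₀ + (β₂₃ : ExteriorAlgebra ℤ M) * h₁
      + ((n₁ : ExteriorAlgebra ℤ M) * l₁ + (n₂ : ExteriorAlgebra ℤ M) * l₂ + (n₃ : ExteriorAlgebra ℤ M) * l₃ + (n₄ : ExteriorAlgebra ℤ M) * l₄))
    (hp : β₀₁ * β₂₃ + (n₂ * n₃ - n₁ * n₄) = 2 * p + 1)
    (hX : X = c 0 1 • (ι ℤ (x 0) * ι ℤ (x 1)) + c 0 2 • (ι ℤ (x 0) * ι ℤ (x 2)) + c 0 3 • (ι ℤ (x 0) * ι ℤ (x 3)) + c 0 4 •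
      (ι ℤ (x 0) * ι ℤ (x 4)) + c 0 5 • (ι ℤ (x 0) * ι ℤ (x 5)) + c 0 6 • (ι ℤ (x 0) * ι ℤ (x 6)) + c 0 7 • (ι
      ℤ (x 0) * ι ℤ (x 7)) + c 0 8 • (ι ℤ (x 0) * ι ℤ (x 8)) + c 0 9 • (ι ℤ (x 0) * ι ℤ (x 9)) + c 0 10 • (ι ℤ
      (x 0) * ι ℤ (x 10)) + c 0 11 • (ι ℤ (x 0) * ι ℤ (x 11)) + c 1 2 • (ι ℤ (x 1) * ι ℤ (x 2)) + c 1 3 • (ι ℤ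
      (x 1) * ι ℤ (x 3)) + c 1 4 • (ι ℤ (x 1) * ι ℤ (x 4)) + c 1 5 • (ι ℤ (x 1) * ι ℤ (x 5)) + c 1 6 • (ι ℤ (x
      1) * ι ℤ (x 6)) + c 1 7 • (ι ℤ (x 1) * ι ℤ (x 7)) + c 1 8 • (ι ℤ (x 1) * ι ℤ (x 8)) + c 1 9 • (ι ℤ (x 1)
      * ι ℤ (x 9)) + c 1 10 • (ι ℤ (x 1) * ι ℤ (x 10)) + c 1 11 • (ι ℤ (x 1) * ι ℤ (x 11)) + c 2 3 • (ι ℤ (x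
      2) * ι ℤ (x 3)) + c 2 4 • (ι ℤ (x 2) * ι ℤ (x 4)) + c 2 5 • (ι ℤ (x 2) * ι ℤ (x 5)) + c 2 6 • (ι ℤ (x 2)
      * ι ℤ (x 6)) + c 2 7 • (ι ℤ (x 2) * ι ℤ (x 7)) + c 2 8 • (ι ℤ (x 2) * ι ℤ (x 8)) + c 2 9 • (ι ℤ (x 2) *
      ι ℤ (x 9)) + c 2 10 • (ι ℤ (x 2) * ι ℤ (x 10)) + c 2 11 • (ι ℤ (x 2) * ι ℤ (x 11)) + c 3 4 • (ι ℤ (x 3)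
      * ι ℤ (x 4)) + c 3 5 • (ι ℤ (x 3) * ι ℤ (x 5)) + c 3 6 • (ι ℤ (x 3) * ι ℤ (x 6)) + c 3 7 • (ι ℤ (x 3) *
      ι ℤ (x 7)) + c 3 8 • (ι ℤ (x 3) * ι ℤ (x 8)) + c 3 9 • (ι ℤ (x 3) * ι ℤ (x 9)) + c 3 10 • (ι ℤ (x 3) * ι
      ℤ (x 10)) + c 3 11 • (ι ℤ (x 3) * ι ℤ (x 11)) + c 4 5 • (ι ℤ (x 4) * ι ℤ (x 5)) + c 4 6 • (ι ℤ (x 4) * ι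
      ℤ (x 6)) + c 4 7 • (ι ℤ (x 4) * ι ℤ (x 7)) + c 4 8 • (ι ℤ (x 4) * ι ℤ (x 8)) + c 4 9 • (ι ℤ (x 4) * ι ℤ
      (x 9)) + c 4 10 • (ι ℤ (x 4) * ι ℤ (x 10)) + c 4 11 • (ι ℤ (x 4) * ι ℤ (x 11)) + c 5 6 • (ι ℤ (x 5) * ι
      ℤ (x 6)) + c 5 7 • (ι ℤ (x 5) * ι ℤ (x 7)) + c 5 8 • (ι ℤ (x 5) * ι ℤ (x 8)) + c 5 9 • (ι ℤ (x 5) * ι ℤ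
      (x 9)) + c 5 10 • (ι ℤ (x 5) * ι ℤ (x 10)) + c 5 11 • (ι ℤ (x 5) * ι ℤ (x 11)) + c 6 7 • (ι ℤ (x 6) * ι
      ℤ (x 7)) + c 6 8 • (ι ℤ (x 6) * ι ℤ (x 8)) + c 6 9 • (ι ℤ (x 6) * ι ℤ (x 9)) + c 6 10 • (ι ℤ (x 6) * ι ℤ
      (x 10)) + c 6 11 • (ι ℤ (x 6) * ι ℤ (x 11)) + c 7 8 • (ι ℤ (x 7) * ι ℤ (x 8)) + c 7 9 • (ι ℤ (x 7) * ι ℤ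
      (x 9)) + c 7 10 • (ι ℤ (x 7) * ι ℤ (x 10)) + c 7 11 • (ι ℤ (x 7) * ι ℤ (x 11)) + c 8 9 • (ι ℤ (x 8) * ι
      ℤ (x 9)) + c 8 10 • (ι ℤ (x 8) * ι ℤ (x 10)) + c 8 11 • (ι ℤ (x 8) * ι ℤ (x 11)) + c 9 10 • (ι ℤ (x 9) *
      ι ℤ (x 10)) + c 9 11 • (ι ℤ (x 9) * ι ℤ (x 11)) + c 10 11 • (ι ℤ (x 10) * ι ℤ (x 11)))
    (hB : B = C + 2 * X) (qB : B * B = 2 * B₂) (cB : B * B * B = 6 * B₃)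
    (hσ₁ : σ₁ = 0) (hσ₂ : σ₂ = 4 * t - σ₀) (hσ₀ : σ₀ = 2 * s + 1) (hσ₃ : σ₃ = 4 * u)
    (hT₂ : T₂ = σ₂ * D₂ - 4 * σ₁ * (D * B) + 16 * σ₀ * B₂)
    (hT₃ : T₃ = σ₃ * D₃ - 4 * σ₂ * (D₂ * B) + 16 * σ₁ * (D * B₂) - 64 * σ₀ * B₃) :
    ∀ Z₂ ∈ Λ, ∀ Z₃ : ExteriorAlgebra ℤ M, ¬ (T₂ = 64 * Z₂ ∧ T₃ = 1024 * Z₃) := by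
  rintro Z₂ mZ₂ Z₃ ⟨hcrit₂, hcrit₃⟩
  -- memberships
  have mh₀ : h₀ ∈ Λ := hΛ ▸ Algebra.subset_adjoin ⟨(x 0, x 1), hh₀.symm⟩
  have mh₁ : h₁ ∈ Λ := hΛ ▸ Algebra.subset_adjoin ⟨(x 2, x 3), hh₁.symm⟩
  have ml₁ : l₁ ∈ Λ := hΛ ▸ Algebra.subset_adjoin ⟨(x 0, x 2), hl₁.symm⟩
  have ml₂ : l₂ ∈ Λ := hΛ ▸ Algebra.subset_adjoin ⟨(x 0, x 3), hl₂.symm⟩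
  have ml₃ : l₃ ∈ Λ := hΛ ▸ Algebra.subset_adjoin ⟨(x 1, x 2), hl₃.symm⟩
  have ml₄ : l₄ ∈ Λ := hΛ ▸ Algebra.subset_adjoin ⟨(x 1, x 3), hl₄.symm⟩
  have mh₂ : h₂ ∈ Λ := hΛ ▸ Algebra.subset_adjoin ⟨(x 4, x 5), hh₂.symm⟩
  have mh₃ : h₃ ∈ Λ := hΛ ▸ Algebra.subset_adjoin ⟨(x 6, x 7), hh₃.symm⟩
  have mh₄ : h₄ ∈ Λ := hΛ ▸ Algebra.subset_adjoin ⟨(x 8, x 9), hh₄.symm⟩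
  have mh₅ : h₅ ∈ Λ := hΛ ▸ Algebra.subset_adjoin ⟨(x 10, x 11), hh₅.symm⟩
  have mH : H ∈ Λ := by rw [hH]; exact Λ.add_mem mh₀ mh₁
  have mS₂ : S₂ ∈ Λ := by
    rw [hS₂]; exact Λ.add_mem (Λ.add_mem (Λ.add_mem (Λ.add_mem (Λ.add_mem (Λ.mul_mem mh₂ mh₃)
      (Λ.mul_mem mh₂ mh₄)) (Λ.mul_mem mh₂ mh₅)) (Λ.mul_mem mh₃ mh₄)) (Λ.mul_mem mh₃ mh₅)) (Λ.mul_mem mh₄ mh₅)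
  have mS₃ : S₃ ∈ Λ := by
    rw [hS₃]; exact Λ.add_mem (Λ.add_mem (Λ.add_mem (Λ.mul_mem (Λ.mul_mem mh₂ mh₃) mh₄)
      (Λ.mul_mem (Λ.mul_mem mh₂ mh₃) mh₅)) (Λ.mul_mem (Λ.mul_mem mh₂ mh₄) mh₅)) (Λ.mul_mem (Λ.mul_mem mh₃ mh₄) mh₅)
  have mk : ∀ k : ℤ, (k : ExteriorAlgebra ℤ M) ∈ Λ := fun k => Subalgebra.intCast_mem Λ k
  have span_le : Submodule.span ℤ (Set.range fun p : M × M => ι ℤ p.1 * ι ℤ p.2) ≤ Subalgebra.toSubmodule Λ := by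
    rw [hΛ]; exact Algebra.span_le_adjoin ℤ _
  -- the first digit and its divided powers (ROW H)
  have mXspan : X ∈ Submodule.span ℤ (Set.range fun p : M × M => ι ℤ p.1 * ι ℤ p.2) := hX ▸ twoForm_mem_span x c
  have mX : X ∈ Λ := span_le mXspan
  obtain ⟨X₂, mX₂', X₃, mX₃', qX, cX⟩ := exists_dividedPowers_of_mem_span X mXspan
  have mX₂ : X₂ ∈ Λ := hΛ ▸ mX₂'
  have mX₃ : X₃ ∈ Λ := hΛ ▸ mX₃'
  -- the Pfaffian, cast
  have hpA : (β₀₁ : ExteriorAlgebra ℤ M) * (β₂₃ : ExteriorAlgebra ℤ M) + ((n₂ : ExteriorAlgebra ℤ M) * (n₃ : ExteriorAlgebra ℤ M) - (n₁ : ExteriorAlgebra ℤ M) * (n₄ : ExteriorAlgebra ℤ M)) = 2 * (p : ExteriorAlgebra ℤ M) + 1 := by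
    exact_mod_cast congrArg (Int.cast : ℤ → ExteriorAlgebra ℤ M) hp
  -- the registered closed forms of `B = C + 2X` from `B₂, B₃` (FILE I + torsion-freeness)
  obtain ⟨k₂, k₃⟩ := closedForms_leading (R := ℤ) x Λ h₀ h₁ l₁ l₂ l₃ l₄ (n₁ : ExteriorAlgebra ℤ M) (n₂ : ExteriorAlgebra ℤ M) (n₃ : ExteriorAlgebra ℤ M) (n₄ : ExteriorAlgebra ℤ M)
    (β₀₁ : ExteriorAlgebra ℤ M) (β₂₃ : ExteriorAlgebra ℤ M) _ _ C _ _ X X₂ X₃ B hΛ hh₀ hh₁ hl₁ hl₂ hl₃ hl₄ (mk n₁) (mk n₂) (mk n₃) (mk n₄) (mk β₀₁)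
    (mk β₂₃) mX mX₂ mX₃ rfl rfl hC rfl rfl qX cX hB
  have hB₂c := cancel_two x (qB.symm.trans k₂)
  have hB₃c := cancel_six x (cB.symm.trans k₃)
  rcases trichotomy β₀₁ β₂₃ n₁ n₂ n₃ n₄ with ⟨r, hr⟩ | ⟨c₁, c₂, c₃, c₄, m, hm⟩ |
      ⟨a₀, a₁, e₁, e₂, e₃, e₄, hb₀₁, hb₂₃, hn₁, hn₂, hn₃, hn₄⟩
  · /- (1) the twelve (V)-kills: LEMMA D(a) with remainder -/
    have hrA : (β₀₁ : ExteriorAlgebra ℤ M) + (β₂₃ : ExteriorAlgebra ℤ M) = 2 * (r : ExteriorAlgebra ℤ M) + 1 := by exact_mod_cast congrArg (Int.cast : ℤ → ExteriorAlgebra ℤ M) hr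
    refine lemmaD_a_reading x Λ h₀ h₁ l₁ l₂ l₃ l₄ h₂ h₃ h₄ h₅ σ₀ σ₁ σ₂ σ₃ s t u (p : ExteriorAlgebra ℤ M) (r : ExteriorAlgebra ℤ M)
      ((n₂ : ExteriorAlgebra ℤ M) * (n₃ : ExteriorAlgebra ℤ M) - (n₁ : ExteriorAlgebra ℤ M) * (n₄ : ExteriorAlgebra ℤ M)) (n₁ : ExteriorAlgebra ℤ M) (n₂ : ExteriorAlgebra ℤ M) (n₃ : ExteriorAlgebra ℤ M) (n₄ : ExteriorAlgebra ℤ M)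
      (β₀₁ : ExteriorAlgebra ℤ M) (β₂₃ : ExteriorAlgebra ℤ M) H H₂ S₁ S₂ S₃ _ _ D D₂ D₃ C _ _ X X₂ X₃ B₂ B₃ T₃ hΛ hh₀ hh₁ hl₁ hl₂ hl₃ hl₄
      hh₂ hh₃ hh₄ hh₅ ms mt mu (mk p) (mk r) (mk n₁) (mk n₂) (mk n₃) (mk n₄) (mk β₀₁) (mk β₂₃) mS₂ mS₃ mX mX₂ mX₃
      hH hH₂ hS₁ rfl rfl rfl hD hD₂ hD₃ hC rfl rfl hB₂c hB₃c (by rw [hT₃, hB]) hpA hrA hσ₁ hσ₂ hσ₀ hσ₃ (4 * Z₃) ?_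
    rw [hcrit₃, ← mul_assoc]; norm_num
  · /- (2) a cross-line functional with even pairing: LEMMA A(a), inconsistent direction -/
    have hmA : (β₂₃ : ExteriorAlgebra ℤ M) + ((c₂ : ExteriorAlgebra ℤ M) * (n₃ : ExteriorAlgebra ℤ M) + (c₃ : ExteriorAlgebra ℤ M) * (n₂ : ExteriorAlgebra ℤ M) - (c₁ : ExteriorAlgebra ℤ M) * (n₄ : ExteriorAlgebra ℤ M)
        - (c₄ : ExteriorAlgebra ℤ M) * (n₁ : ExteriorAlgebra ℤ M)) = 2 * (m : ExteriorAlgebra ℤ M) := by exact_mod_cast congrArg (Int.cast : ℤ → ExteriorAlgebra ℤ M) hm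
    exact lemmaA_a_chain x Λ h₀ h₁ l₁ l₂ l₃ l₄ h₂ h₃ h₄ h₅ σ₀ σ₁ σ₂ s t (p : ExteriorAlgebra ℤ M) (m : ExteriorAlgebra ℤ M) _ (n₁ : ExteriorAlgebra ℤ M) (n₂ : ExteriorAlgebra ℤ M)
      (n₃ : ExteriorAlgebra ℤ M) (n₄ : ExteriorAlgebra ℤ M) (c₁ : ExteriorAlgebra ℤ M) (c₂ : ExteriorAlgebra ℤ M) (c₃ : ExteriorAlgebra ℤ M) (c₄ : ExteriorAlgebra ℤ M) (β₀₁ : ExteriorAlgebra ℤ M) (β₂₃ : ExteriorAlgebra ℤ M) H H₂ S₁ S₂ _ _ _ _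
      _ C _ X X₂ 0 0 B₂ D D₂ T₂ Z₂ hΛ hh₀ hh₁ hl₁ hl₂ hl₃ hl₄ hh₂ hh₃ hh₄ hh₅ ms mt (mk p) (mk m) (mk n₁) (mk n₂)
      (mk n₃) (mk n₄) (mk c₁) (mk c₂) (mk c₃) (mk c₄) (mk β₀₁) (mk β₂₃) mS₂ mX mX₂ Λ.zero_mem Λ.zero_mem mZ₂ hH hH₂
      hS₁ rfl rfl rfl rfl rfl rfl hC rfl (hB₂c.trans (by simp only [mul_zero, add_zero])) hD hD₂
      (by rw [hT₂, hB]; simp only [mul_zero, add_zero]) hpA hmA hσ₁ hσ₂ hσ₀ hcrit₂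
  · /- (3) `C ≡ H mod 2`: LEMMA A(a) consistent direction → clause → parametrisation → LEMMA B -/
    -- re-centre: `B = H + 2X'`, `X' = X + A` an integral 2-form
    set X' : ExteriorAlgebra ℤ M := X + ((a₀ : ExteriorAlgebra ℤ M) * h₀ + (a₁ : ExteriorAlgebra ℤ M) * h₁ + ((e₁ : ExteriorAlgebra ℤ M) * l₁ + (e₂ : ExteriorAlgebra ℤ M) * l₂ + (e₃ : ExteriorAlgebra ℤ M) * l₃
      + (e₄ : ExteriorAlgebra ℤ M) * l₄)) with hX'
    have hBH : B = H + 2 * X' := by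
      rw [hB, hC, hX', hH, recentre h₀ h₁ l₁ l₂ l₃ l₄ β₀₁ β₂₃ n₁ n₂ n₃ n₄ a₀ a₁ e₁ e₂ e₃ e₄ hb₀₁ hb₂₃ hn₁ hn₂ hn₃ hn₄]
      noncomm_ring
    have mX'span : X' ∈ Submodule.span ℤ (Set.range fun p : M × M => ι ℤ p.1 * ι ℤ p.2) := by
      rw [hX', hh₀, hh₁, hl₁, hl₂, hl₃, hl₄]
      refine Submodule.add_mem _ mXspan (Submodule.add_mem _ (Submodule.add_mem _ ?_ ?_)
        (Submodule.add_mem _ (Submodule.add_mem _ (Submodule.add_mem _ ?_ ?_) ?_) ?_)) <;>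
        exact intCast_mul_twoVector_mem_span _ _ _
    have mX' : X' ∈ Λ := span_le mX'span
    obtain ⟨X'₂, mX'₂', X'₃, -, qX', -⟩ := exists_dividedPowers_of_mem_span X' mX'span
    have mX'₂ : X'₂ ∈ Λ := hΛ ▸ mX'₂'
    have ke₂ := closedForms_edge (R := ℤ) x Λ h₀ h₁ H H₂ X' X'₂ B hΛ hh₀ hh₁ mX' mX'₂ hH hH₂ qX' hBH
    have hB₂e := cancel_two x (qB.symm.trans ke₂)
    -- criterion at k = 2 ⇒ the digit equation
    obtain ⟨W, -, hW⟩ := edge_digit_equation x Λ h₀ h₁ h₂ h₃ h₄ h₅ σ₀ σ₁ σ₂ s t H H₂ S₁ S₂ X' X'₂ 0 0 B₂ D D₂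
      T₂ Z₂ hΛ hh₀ hh₁ hh₂ hh₃ hh₄ hh₅ ms mt mS₂ mX' mX'₂ Λ.zero_mem Λ.zero_mem mZ₂ hH hH₂ hS₁
      (hB₂e.trans (by simp only [mul_zero, add_zero])) hD hD₂ (by rw [hT₂, hBH]; simp only [mul_zero, add_zero])
      hσ₁ hσ₂ hσ₀ hcrit₂
    -- the coefficients of `X' − S₁` and the digit-space clause
    set c'' : Fin 12 → Fin 12 → ℤ := fun i j => c i j + (![![0, a₀, e₁, e₂, 0, 0, 0, 0, 0, 0, 0, 0], ![0, 0, e₃, e₄, 0, 0, 0, 0, 0, 0, 0, 0], ![0, 0, 0, a₁, 0,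
        0, 0, 0, 0, 0, 0, 0], ![0, 0, 0, 0, 0, 0, 0, 0, 0, 0, 0, 0], ![0, 0, 0, 0, 0, -1, 0, 0, 0, 0, 0,
        0], ![0, 0, 0, 0, 0, 0, 0, 0, 0, 0, 0, 0], ![0, 0, 0, 0, 0, 0, 0, -1, 0, 0, 0, 0], ![0, 0, 0, 0,
        0, 0, 0, 0, 0, 0, 0, 0], ![0, 0, 0, 0, 0, 0, 0, 0, 0, -1, 0, 0], ![0, 0, 0, 0, 0, 0, 0, 0, 0, 0,
        0, 0], ![0, 0, 0, 0, 0, 0, 0, 0, 0, 0, 0, -1], ![0, 0, 0, 0, 0, 0, 0, 0, 0, 0, 0, 0]] : Fin 12 → Fin 12 → ℤ) i j with hc''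
    have hY : X' - S₁ = c'' 0 1 • (ι ℤ (x 0) * ι ℤ (x 1)) + c'' 0 2 • (ι ℤ (x 0) * ι ℤ (x 2)) + c'' 0 3 • (ι ℤ (x 0) * ι ℤ (x 3)) +
      c'' 0 4 • (ι ℤ (x 0) * ι ℤ (x 4)) + c'' 0 5 • (ι ℤ (x 0) * ι ℤ (x 5)) + c'' 0 6 • (ι ℤ (x 0) * ι ℤ (x
      6)) + c'' 0 7 • (ι ℤ (x 0) * ι ℤ (x 7)) + c'' 0 8 • (ι ℤ (x 0) * ι ℤ (x 8)) + c'' 0 9 • (ι ℤ (x 0) * ι ℤ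
      (x 9)) + c'' 0 10 • (ι ℤ (x 0) * ι ℤ (x 10)) + c'' 0 11 • (ι ℤ (x 0) * ι ℤ (x 11)) + c'' 1 2 • (ι ℤ (x
      1) * ι ℤ (x 2)) + c'' 1 3 • (ι ℤ (x 1) * ι ℤ (x 3)) + c'' 1 4 • (ι ℤ (x 1) * ι ℤ (x 4)) + c'' 1 5 • (ι ℤ
      (x 1) * ι ℤ (x 5)) + c'' 1 6 • (ι ℤ (x 1) * ι ℤ (x 6)) + c'' 1 7 • (ι ℤ (x 1) * ι ℤ (x 7)) + c'' 1 8 •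
      (ι ℤ (x 1) * ι ℤ (x 8)) + c'' 1 9 • (ι ℤ (x 1) * ι ℤ (x 9)) + c'' 1 10 • (ι ℤ (x 1) * ι ℤ (x 10)) + c''
      1 11 • (ι ℤ (x 1) * ι ℤ (x 11)) + c'' 2 3 • (ι ℤ (x 2) * ι ℤ (x 3)) + c'' 2 4 • (ι ℤ (x 2) * ι ℤ (x 4))
      + c'' 2 5 • (ι ℤ (x 2) * ι ℤ (x 5)) + c'' 2 6 • (ι ℤ (x 2) * ι ℤ (x 6)) + c'' 2 7 • (ι ℤ (x 2) * ι ℤ (x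
      7)) + c'' 2 8 • (ι ℤ (x 2) * ι ℤ (x 8)) + c'' 2 9 • (ι ℤ (x 2) * ι ℤ (x 9)) + c'' 2 10 • (ι ℤ (x 2) * ι
      ℤ (x 10)) + c'' 2 11 • (ι ℤ (x 2) * ι ℤ (x 11)) + c'' 3 4 • (ι ℤ (x 3) * ι ℤ (x 4)) + c'' 3 5 • (ι ℤ (x
      3) * ι ℤ (x 5)) + c'' 3 6 • (ι ℤ (x 3) * ι ℤ (x 6)) + c'' 3 7 • (ι ℤ (x 3) * ι ℤ (x 7)) + c'' 3 8 • (ι ℤ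
      (x 3) * ι ℤ (x 8)) + c'' 3 9 • (ι ℤ (x 3) * ι ℤ (x 9)) + c'' 3 10 • (ι ℤ (x 3) * ι ℤ (x 10)) + c'' 3 11
      • (ι ℤ (x 3) * ι ℤ (x 11)) + c'' 4 5 • (ι ℤ (x 4) * ι ℤ (x 5)) + c'' 4 6 • (ι ℤ (x 4) * ι ℤ (x 6)) + c''
      4 7 • (ι ℤ (x 4) * ι ℤ (x 7)) + c'' 4 8 • (ι ℤ (x 4) * ι ℤ (x 8)) + c'' 4 9 • (ι ℤ (x 4) * ι ℤ (x 9)) +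
      c'' 4 10 • (ι ℤ (x 4) * ι ℤ (x 10)) + c'' 4 11 • (ι ℤ (x 4) * ι ℤ (x 11)) + c'' 5 6 • (ι ℤ (x 5) * ι ℤ
      (x 6)) + c'' 5 7 • (ι ℤ (x 5) * ι ℤ (x 7)) + c'' 5 8 • (ι ℤ (x 5) * ι ℤ (x 8)) + c'' 5 9 • (ι ℤ (x 5) *
      ι ℤ (x 9)) + c'' 5 10 • (ι ℤ (x 5) * ι ℤ (x 10)) + c'' 5 11 • (ι ℤ (x 5) * ι ℤ (x 11)) + c'' 6 7 • (ι ℤ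
      (x 6) * ι ℤ (x 7)) + c'' 6 8 • (ι ℤ (x 6) * ι ℤ (x 8)) + c'' 6 9 • (ι ℤ (x 6) * ι ℤ (x 9)) + c'' 6 10 •
      (ι ℤ (x 6) * ι ℤ (x 10)) + c'' 6 11 • (ι ℤ (x 6) * ι ℤ (x 11)) + c'' 7 8 • (ι ℤ (x 7) * ι ℤ (x 8)) + c''
      7 9 • (ι ℤ (x 7) * ι ℤ (x 9)) + c'' 7 10 • (ι ℤ (x 7) * ι ℤ (x 10)) + c'' 7 11 • (ι ℤ (x 7) * ι ℤ (x
      11)) + c'' 8 9 • (ι ℤ (x 8) * ι ℤ (x 9)) + c'' 8 10 • (ι ℤ (x 8) * ι ℤ (x 10)) + c'' 8 11 • (ι ℤ (x 8) *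
      ι ℤ (x 11)) + c'' 9 10 • (ι ℤ (x 9) * ι ℤ (x 10)) + c'' 9 11 • (ι ℤ (x 9) * ι ℤ (x 11)) + c'' 10 11 • (ι
      ℤ (x 10) * ι ℤ (x 11)) := by
      simp only [hc'', Matrix.cons_val', Matrix.cons_val_zero, Matrix.cons_val_one, Matrix.cons_val,
        Matrix.empty_val', Matrix.cons_val_fin_one, add_zero]
      rw [hX', hX, hS₁, hh₀, hh₁, hh₂, hh₃, hh₄, hh₅, hl₁, hl₂, hl₃, hl₄]
      simp only [← zsmul_eq_mul]
      module
    have hWY : (ι ℤ (x 0) * ι ℤ (x 1) + ι ℤ (x 2) * ι ℤ (x 3)) * (X' - S₁) = 2 * W := hW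
    obtain ⟨p0, p0_4, p0_5, p0_6, p0_7, p0_8, p0_9, p0_10, p0_11, p1_4, p1_5, p1_6, p1_7, p1_8, p1_9, p1_10, p1_11,
      p2_4, p2_5, p2_6, p2_7, p2_8, p2_9, p2_10, p2_11, p3_4, p3_5, p3_6, p3_7, p3_8, p3_9, p3_10,
      p3_11, p4_5, p4_6, p4_7, p4_8, p4_9, p4_10, p4_11, p5_6, p5_7, p5_8, p5_9, p5_10, p5_11, p6_7,
      p6_8, p6_9, p6_10, p6_11, p7_8, p7_9, p7_10, p7_11, p8_9, p8_10, p8_11, p9_10, p9_11, p10_11⟩ := digitSpace_clause x c'' (X' - S₁) W hY hWY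
    have pid := parametrisation_identity (fun i j => ι ℤ (x i) * ι ℤ (x j)) c'' p0 p0_4 p0_5 p0_6 p0_7 p0_8 p0_9 p0_10 p0_11 p1_4 p1_5 p1_6 p1_7 p1_8 p1_9 p1_10 p1_11 p2_4 p2_5 p2_6
      p2_7 p2_8 p2_9 p2_10 p2_11 p3_4 p3_5 p3_6 p3_7 p3_8 p3_9 p3_10 p3_11 p4_5 p4_6 p4_7 p4_8 p4_9
      p4_10 p4_11 p5_6 p5_7 p5_8 p5_9 p5_10 p5_11 p6_7 p6_8 p6_9 p6_10 p6_11 p7_8 p7_9 p7_10 p7_11 p8_9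
      p8_10 p8_11 p9_10 p9_11 p10_11
    try dsimp only at pid
    obtain ⟨Er, hX'Er, mErspan⟩ : ∃ Er : ExteriorAlgebra ℤ M, X' = S₁ + (((c'' 0 2 : ExteriorAlgebra ℤ M) * (ι ℤ (x 0) * ι ℤ (x 2)) + (c'' 0 3 : ExteriorAlgebra ℤ M) * (ι ℤ (x 0) * ι
        ℤ (x 3)) + (c'' 1 2 : ExteriorAlgebra ℤ M) * (ι ℤ (x 1) * ι ℤ (x 2)) + (c'' 1 3 : ExteriorAlgebra ℤ M)
        * (ι ℤ (x 1) * ι ℤ (x 3))) + (c'' 0 1 : ExteriorAlgebra ℤ M) * ((ι ℤ (x 0) * ι ℤ (x 1)) + (ι ℤ (x 2) *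
        ι ℤ (x 3)))
        + 2 * Er) ∧ Er ∈ Submodule.span ℤ (Set.range fun p : M × M => ι ℤ p.1 * ι ℤ p.2) :=
      ⟨_, eq_add_of_sub_eq' (hY.trans pid), by
        repeat (first
          | refine Submodule.add_mem _ ?_ ?_
          | exact intCast_mul_twoVector_mem_span _ _ _)⟩
    rw [← hl₁, ← hl₂, ← hl₃, ← hl₄, ← hh₀, ← hh₁, ← hH] at hX'Er
    have mEr : Er ∈ Λ := span_le mErspan
    obtain ⟨Er₂, mEr₂', Er₃, mEr₃', qEr, cEr⟩ := exists_dividedPowers_of_mem_span Er mErspan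
    have mEr₂ : Er₂ ∈ Λ := hΛ ▸ mEr₂'
    have mEr₃ : Er₃ ∈ Λ := hΛ ▸ mEr₃'
    -- `B = B₀ + 4E′` with lemmaB's `B₀ = (1 + 2η)H + 2S₁ + 2L`
    have hBB₀ : B = ((1 + 2 * (c'' 0 1 : ExteriorAlgebra ℤ M)) * H + 2 * S₁ + 2 * ((c'' 0 2 : ExteriorAlgebra ℤ M) * l₁ + (c'' 0 3 : ExteriorAlgebra ℤ M) * l₂
        + (c'' 1 2 : ExteriorAlgebra ℤ M) * l₃ + (c'' 1 3 : ExteriorAlgebra ℤ M) * l₄)) + 4 * Er := by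
      rw [hBH, hX'Er]; noncomm_ring
    obtain ⟨f₂, f₃⟩ := closedForms_lemmaB (R := ℤ) x Λ h₀ h₁ l₁ l₂ l₃ l₄ h₂ h₃ h₄ h₅ (c'' 0 1 : ExteriorAlgebra ℤ M) (c'' 0 2 : ExteriorAlgebra ℤ M)
      (c'' 0 3 : ExteriorAlgebra ℤ M) (c'' 1 2 : ExteriorAlgebra ℤ M) (c'' 1 3 : ExteriorAlgebra ℤ M) H H₂ S₁ S₂ S₃ _ _ _ _ _ Er Er₂ Er₃ B hΛ hh₀ hh₁ hl₁ hl₂ hl₃ hl₄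
      hh₂ hh₃ hh₄ hh₅ (mk _) (mk _) (mk _) (mk _) (mk _) mEr mEr₂ mEr₃ hH hH₂ hS₁ hS₂ hS₃ rfl rfl rfl rfl rfl qEr cEr
      hBB₀
    have hB₂f := cancel_two x (qB.symm.trans f₂)
    have hB₃f := cancel_six x (cB.symm.trans f₃)
    -- LEMMA B reading: `T₃ ∉ 1024Λ`
    exact (lemmaB_reading x Λ h₀ h₁ l₁ l₂ l₃ l₄ h₂ h₃ h₄ h₅ σ₀ σ₁ σ₂ σ₃ s t u (c'' 0 1 : ExteriorAlgebra ℤ M) (c'' 0 2 : ExteriorAlgebra ℤ M)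
      (c'' 0 3 : ExteriorAlgebra ℤ M) (c'' 1 2 : ExteriorAlgebra ℤ M) (c'' 1 3 : ExteriorAlgebra ℤ M) H H₂ S₁ S₂ S₃ _ _ D D₂ D₃ _ _ _ Er Er₂ Er₃ B₂ B₃ T₃ hΛ hh₀ hh₁
      hl₁ hl₂ hl₃ hl₄ hh₂ hh₃ hh₄ hh₅ ms mt mu (mk _) (mk _) (mk _) (mk _) (mk _) mEr mEr₂ mEr₃ hH hH₂ hS₁ hS₂ hS₃ rfl
      rfl hD hD₂ hD₃ rfl rfl rfl hB₂f hB₃f (by rw [hT₃, hBB₀]) hσ₁ hσ₂ hσ₀ hσ₃ Z₃).2 hcrit₃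

end Summit.Ventures.HSemireg.EdgeUnitClassDead
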